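import Summits.AtomisticToContinuum.FouriersLaw.Theses.VanishingNoiseTransfer
import Summits.AtomisticToContinuum.FouriersLaw.Theorems.BondHeatUncertaintyLinearResponseFTURSteadyHeatRatesHelper1
import Summits.AtomisticToContinuum.FouriersLaw.Theorems.PhononMeanFreePathBoundaryKuboEnergyBalance
import Literature.MathematicalPhysics.KineticTheory.VelocityFlipNoise
import Literature.MathematicalPhysics.KineticTheory.HardTetherChain

/-!
# Flip-invariant test functions for weak flip-steady states; the truncated energy
(brick for crux stmt-AtomisticToContinuum-11976 `VanishingNoiseTransfer.VanishingNoiseBound`, line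
`fekete-usc-one-length`, stub S3 `stub_noisyPositiveConductance`; worker file 1/3)

A weak steady state `μ` of the flip-noisy pinned chain `L + εS` (`OscillatorChain.IsFlipSteadyState`:
probability, `∫ (L f + ε S f) dμ = 0` for `f ∈ C_c^∞`, bond currents integrable) satisfies the DETERMINISTIC
weak equation `∫ L f dμ = 0` on every flip-invariant test function, at every rate `ε`, because the flip term
vanishes pointwise (`integral_generator_eq_zero_of_flipInvariant`; Bernardin–Olla 2011 §2.1, `S H = 0`). The
energy bookkeeping of the sequel files tests it on functions of `H` and on (cut-off) block energies, all even
in each momentum. This file supplies the calculus: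

* the truncated energy `f_R = R φ(H/R) − R φ(2)` (`φ = linCutoff`, `φ' = χ = smoothCutoff ∈ [0,1]`, `χ = 1` on
  `(-∞,1]`, `0` on `[2,∞)`): smooth, compactly supported (`H` proper), flip-invariant, and
  `L f_R = γ[(T_L+T_R) χ(H/R) − χ(H/R)(p_0² + p_{N-1}²) + R⁻¹χ'(H/R)(T_L p_0² + T_R p_{N-1}²)]`
  (`generator_truncEnergy`; only the baths act on functions of `H`, BLR 2000 §5.2 eq. (25));
* pointwise facts on the energy cut-off `χ(H/R)` along `R = n + 1 → ∞` (eventually `χ = 1`, `χ' = 0`), and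
  the uniform bound `|R⁻¹χ'(H/R) p_k²| ≤ 4‖χ'‖_∞` (`p² ≤ 2H ≤ 4R` on the support of `χ'(H/R)`), which is what
  makes the end kinetic temperatures come out WITHOUT any a priori moment of `μ`;
* the cut-off left block energies `E_{≤i} χ(H/R)` (`HardTether.leftEnergy`, BLR's `∑_{k≤i} h(k)`): smooth,
  flip-invariant, `0 ≤ E_{≤i} ≤ H`, the closed form of `L(E_{≤i} χ(H/R))`
  (`generator_leftEnergy_cutoff`: `χ(H/R)(γ(T_L − p_0²) − j_i)` plus shell terms, BLR 2000 §5.2 (25)–(26)) and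
  the uniform bounds `|E_{≤i} R⁻²χ''(H/R) p_k²| ≤ 8‖χ''‖_∞`, `|E_{≤i} R⁻¹χ'(H/R)| ≤ 2‖χ'‖_∞` on the shell terms.
-/

noncomputable section

namespace Summit.AtomisticToContinuum.FouriersLaw.Theorems.VanishingNoiseBound

open MeasureTheory Filter Topology Set
open scoped ContDiff NNReal ENNReal
open Literature.MathematicalPhysics.KineticTheory
open Literature.MathematicalPhysics.KineticTheory.HeatConduction
open Literature.MathematicalPhysics.KineticTheory.HeatConduction.HardTether
  (leftEnergy blockWeight bondWeight bondCurrent_add_generator_leftEnergy partialP_leftEnergy)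
open Summit.AtomisticToContinuum.FouriersLaw.Theorems.SubdiffusiveBondHeat
open Summit.AtomisticToContinuum.FouriersLaw.Theorems.LinearResponseFTUR

variable {N : ℕ}

/-! ### Flip-invariant test functions: the flip term drops out pointwise -/

/-- `S f = 0` pointwise for a flip-invariant observable. [folklore] -/
theorem flipNoise_eq_zero_of_invariant {f : PhaseSpace N → ℝ}
    (hf : ∀ (i : Fin N) (x : PhaseSpace N), f (momentumFlip i x) = f x) (x : PhaseSpace N) :
    flipNoise N f x = 0 := by
  simp [flipNoise_eq, hf]

/-- `L_ε f = L f` for a flip-invariant observable, at every rate `ε`. [folklore] -/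
theorem flipGenerator_eq_generator_of_invariant (P : OscillatorChain) (T_L T_R ε : ℝ)
    {f : PhaseSpace N → ℝ} (hf : ∀ (i : Fin N) (x : PhaseSpace N), f (momentumFlip i x) = f x) :
    P.flipGenerator N T_L T_R ε f = P.generator N T_L T_R f := by
  funext x
  rw [P.flipGenerator_eq_add_flipNoise, flipNoise_eq_zero_of_invariant hf x, mul_zero, add_zero]

/-- **Weak flip-stationarity on flip-invariant test functions is the deterministic weak equation**:
`∫ L f dμ = 0` for every flip-invariant `f ∈ C_c^∞` and every flip steady state `μ` (any rate `ε`).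
[Bernardin–Olla 2011, §2.1] [folklore] -/
theorem integral_generator_eq_zero_of_flipInvariant {P : OscillatorChain} {T_L T_R ε : ℝ}
    {μ : Measure (PhaseSpace N)} (hμ : P.IsFlipSteadyState N T_L T_R ε μ)
    {f : PhaseSpace N → ℝ} (hf : ContDiff ℝ ∞ f) (hfc : HasCompactSupport f)
    (hinv : ∀ (i : Fin N) (x : PhaseSpace N), f (momentumFlip i x) = f x) :
    ∫ x, P.generator N T_L T_R f x ∂μ = 0 := by
  rw [← flipGenerator_eq_generator_of_invariant P T_L T_R ε hinv]
  exact hμ.integral_flipGenerator hf hfc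

/-! ### The truncated energy `R φ(H/R) − R φ(2)` as a test function -/

/-- `φ = linCutoff` is smooth (its derivative is the smooth cutoff `χ`). [folklore] -/
theorem contDiff_linCutoff : ContDiff ℝ ∞ linCutoff :=
  contDiff_infty_iff_deriv.2 ⟨differentiable_linCutoff, by
    rw [deriv_linCutoff]; exact contDiff_smoothCutoff⟩

/-- The truncated energy `f_R = R φ(H/R) − R φ(2)` is smooth when the potentials are. [folklore] -/
theorem contDiff_truncEnergy (P : OscillatorChain) (hU : ContDiff ℝ ∞ P.U) (hV : ContDiff ℝ ∞ P.V)
    (N : ℕ) (R : ℝ) :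
    ContDiff ℝ ∞ fun x : PhaseSpace N => R * linCutoff (P.hamiltonian N x / R) - R * linCutoff 2 :=
  (contDiff_const.mul (contDiff_linCutoff.comp ((P.contDiff_hamiltonian hU hV N).div_const R))).sub
    contDiff_const

/-- `f_R` vanishes where `H ≥ 2R` (`R > 0`). [folklore] -/
theorem truncEnergy_eq_zero_of_le (P : OscillatorChain) {R : ℝ} (hR : 0 < R) {x : PhaseSpace N}
    (hx : 2 * R ≤ P.hamiltonian N x) : R * linCutoff (P.hamiltonian N x / R) - R * linCutoff 2 = 0 := by
  have h2 : 2 ≤ P.hamiltonian N x / R := by rw [le_div_iff₀ hR]; linarith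
  rw [linCutoff_of_two_le h2, sub_self]

/-- `f_R` has compact support as soon as `H` has compact sublevel sets (`R > 0`). [folklore] -/
theorem hasCompactSupport_truncEnergy (P : OscillatorChain) (hcpt : ∀ E : ℝ, IsCompact
    {x : PhaseSpace N | P.hamiltonian N x ≤ E}) {R : ℝ} (hR : 0 < R) :
    HasCompactSupport fun x : PhaseSpace N => R * linCutoff (P.hamiltonian N x / R) - R * linCutoff 2 := by
  refine HasCompactSupport.intro (hcpt (2 * R)) fun x hx => ?_
  simp only [mem_setOf_eq, not_le] at hx
  exact truncEnergy_eq_zero_of_le P hR hx.le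

/-- `f_R` is flip-invariant (it is a function of `H`). [folklore] -/
theorem truncEnergy_momentumFlip (P : OscillatorChain) (R : ℝ) (i : Fin N) (x : PhaseSpace N) :
    R * linCutoff (P.hamiltonian N (momentumFlip i x) / R) - R * linCutoff 2 =
      R * linCutoff (P.hamiltonian N x / R) - R * linCutoff 2 := by
  rw [P.hamiltonian_momentumFlip]

/-- **Only the baths act on the truncated energy** (`N ≥ 1`, `R ≠ 0`):
`L f_R = γ[(T_L + T_R) χ(H/R) − χ(H/R)(p_0² + p_{N-1}²) + R⁻¹χ'(H/R)(T_L p_0² + T_R p_{N-1}²)]`.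
[Bonetto–Lebowitz–Rey-Bellet 2000, §5.2 eq. (25)] [folklore] -/
theorem generator_truncEnergy (P : OscillatorChain) (hN : 0 < N)
    (hH : Differentiable ℝ (P.hamiltonian N)) {R : ℝ} (hR : R ≠ 0) (T_L T_R : ℝ) (x : PhaseSpace N) :
    P.generator N T_L T_R (fun y => R * linCutoff (P.hamiltonian N y / R) - R * linCutoff 2) x =
      P.γ * ((T_L + T_R) * smoothCutoff (P.hamiltonian N x / R) -
        smoothCutoff (P.hamiltonian N x / R) *
          (x.2 ⟨0, hN⟩ ^ 2 + x.2 ⟨N - 1, Nat.sub_lt hN one_pos⟩ ^ 2) +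
        deriv smoothCutoff (P.hamiltonian N x / R) / R *
          (T_L * x.2 ⟨0, hN⟩ ^ 2 + T_R * x.2 ⟨N - 1, Nat.sub_lt hN one_pos⟩ ^ 2)) := by
  rw [P.generator_sub_const, generator_comp_hamiltonian_closed P hN hH (hasDerivAt_scaled_linCutoff hR)
    (hasDerivAt_scaled_smoothCutoff R) T_L T_R x]
  ring

/-! ### Pointwise facts about the energy cut-off -/

/-- Far inside the cut-off nothing is truncated: for `H(x) < R` (`R > 0`), `χ(H/R) = 1` and `χ'(H/R) = 0`.
[folklore] -/
theorem smoothCutoff_hamiltonian_of_lt (P : OscillatorChain) {R : ℝ} (hR : 0 < R) {x : PhaseSpace N}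
    (hx : P.hamiltonian N x < R) :
    smoothCutoff (P.hamiltonian N x / R) = 1 ∧ deriv smoothCutoff (P.hamiltonian N x / R) = 0 :=
  ⟨(smoothCutoff_div_of_lt hR hx).1, (smoothCutoff_div_of_lt hR hx).2.1⟩

/-- Along `R = n + 1 → ∞` the cut-off factor at a fixed point is eventually `1`. [folklore] -/
theorem eventually_smoothCutoff_hamiltonian_eq_one (P : OscillatorChain) (x : PhaseSpace N) :
    ∀ᶠ n : ℕ in atTop, smoothCutoff (P.hamiltonian N x / ((n : ℝ) + 1)) = 1 := by
  refine eventually_atTop.2 ⟨⌈P.hamiltonian N x⌉₊, fun n hn => ?_⟩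
  refine (smoothCutoff_hamiltonian_of_lt P (by positivity) ?_).1
  have h1 := Nat.le_ceil (P.hamiltonian N x)
  have h2 : (⌈P.hamiltonian N x⌉₊ : ℝ) ≤ n := by exact_mod_cast hn
  linarith

/-- Along `R = n + 1 → ∞` the derivative of the cut-off factor at a fixed point is eventually `0`.
[folklore] -/
theorem eventually_deriv_smoothCutoff_hamiltonian_eq_zero (P : OscillatorChain) (x : PhaseSpace N) :
    ∀ᶠ n : ℕ in atTop, deriv smoothCutoff (P.hamiltonian N x / ((n : ℝ) + 1)) = 0 := by
  refine eventually_atTop.2 ⟨⌈P.hamiltonian N x⌉₊, fun n hn => ?_⟩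
  refine (smoothCutoff_hamiltonian_of_lt P (by positivity) ?_).2
  have h1 := Nat.le_ceil (P.hamiltonian N x)
  have h2 : (⌈P.hamiltonian N x⌉₊ : ℝ) ≤ n := by exact_mod_cast hn
  linarith

/-- **The key uniform bound**: on the support of `χ'(H/R)` one has `R ≤ H ≤ 2R`, so `p_k² ≤ 2H ≤ 4R` and
`|R⁻¹ χ'(H/R) p_k²| ≤ 4 ‖χ'‖_∞` uniformly in `R > 0` (`U, V ≥ 0`). [folklore] -/
theorem abs_deriv_smoothCutoff_div_mul_sq_le (P : OscillatorChain) (hU0 : ∀ q, 0 ≤ P.U q)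
    (hV0 : ∀ r, 0 ≤ P.V r) {M₁ : ℝ} (hM₁0 : 0 ≤ M₁) (hM₁ : ∀ u, |deriv smoothCutoff u| ≤ M₁)
    {R : ℝ} (hR : 0 < R) (x : PhaseSpace N) (k : Fin N) :
    |deriv smoothCutoff (P.hamiltonian N x / R) / R * x.2 k ^ 2| ≤ 4 * M₁ := by
  by_cases hx : P.hamiltonian N x ≤ 2 * R
  · have hp : x.2 k ^ 2 ≤ 4 * R := by
      have h1 := P.site_le_hamiltonian hU0 hV0 N x k
      have h2 := hU0 (x.1 k)
      linarith
    have e : |deriv smoothCutoff (P.hamiltonian N x / R) / R * x.2 k ^ 2| =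
        |deriv smoothCutoff (P.hamiltonian N x / R)| / R * x.2 k ^ 2 := by
      rw [abs_mul, abs_div, abs_of_pos hR, abs_of_nonneg (sq_nonneg (x.2 k))]
    rw [e]
    calc |deriv smoothCutoff (P.hamiltonian N x / R)| / R * x.2 k ^ 2
        ≤ M₁ / R * (4 * R) := by
          refine mul_le_mul ?_ hp (sq_nonneg _) (div_nonneg hM₁0 hR.le)
          exact div_le_div_of_nonneg_right (hM₁ _) hR.le
      _ = 4 * M₁ := by field_simp
  · have h2 : deriv smoothCutoff (P.hamiltonian N x / R) = 0 := by
      refine deriv_smoothCutoff_eq_zero_of_notMem fun h => ?_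
      have := h.2
      rw [div_le_iff₀ hR] at this
      exact hx (by linarith)
    rw [h2, zero_div, zero_mul, abs_zero]
    positivity

/-- A continuous observable bounded in absolute value is integrable for a finite measure. [folklore] -/
theorem integrable_of_continuous_of_abs_le {μ : Measure (PhaseSpace N)} [IsFiniteMeasure μ]
    {g : PhaseSpace N → ℝ} (hg : Continuous g) {C : ℝ} (hC : ∀ x, |g x| ≤ C) : Integrable g μ :=
  (integrable_const C).mono' hg.aestronglyMeasurable
    (Eventually.of_forall fun x => by rw [Real.norm_eq_abs]; exact hC x)

/-- The truncated end kinetic energies are bounded: `|χ(H/R)(p_0² + p_{N-1}²)| ≤ 8R` (`U, V ≥ 0`, `R > 0`).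
[folklore] -/
theorem abs_smoothCutoff_mul_sq_ends_le (P : OscillatorChain) (hU0 : ∀ q, 0 ≤ P.U q)
    (hV0 : ∀ r, 0 ≤ P.V r) {R : ℝ} (hR : 0 < R) (x : PhaseSpace N) (a b : Fin N) :
    |smoothCutoff (P.hamiltonian N x / R) * (x.2 a ^ 2 + x.2 b ^ 2)| ≤ 8 * R := by
  by_cases hx : P.hamiltonian N x ≤ 2 * R
  · have h1 := P.site_le_hamiltonian hU0 hV0 N x a
    have h2 := P.site_le_hamiltonian hU0 hV0 N x b
    have h3 := hU0 (x.1 a)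
    have h4 := hU0 (x.1 b)
    rw [abs_of_nonneg (mul_nonneg (smoothCutoff_nonneg _) (by positivity))]
    calc smoothCutoff (P.hamiltonian N x / R) * (x.2 a ^ 2 + x.2 b ^ 2)
        ≤ 1 * (x.2 a ^ 2 + x.2 b ^ 2) :=
          mul_le_mul_of_nonneg_right (smoothCutoff_le_one _) (by positivity)
      _ ≤ 8 * R := by linarith
  · have h2 : 2 ≤ P.hamiltonian N x / R := by rw [le_div_iff₀ hR]; linarith
    rw [smoothCutoff_of_two_le h2, zero_mul, abs_zero]
    positivity

/-! ### The left block energy: smoothness, energy bounds, flip invariance -/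

/-- `E_{≤i}` is as smooth as the potentials: the landed `BoundaryKubo.GibbsTtcf.contDiff_leftEnergy`
(`PhononMeanFreePathBoundaryKuboEnergyBalance.lean`), re-exported under the name the sequel files use. [folklore] -/
alias contDiff_leftEnergy' := BoundaryKubo.GibbsTtcf.contDiff_leftEnergy

/-- `0 ≤ E_{≤i} ≤ H` for nonnegative potentials (all weights lie in `[0, 1]`).
-- adapted from `PhononMeanFreePathBoundaryKuboEnergyBalance.leftEnergy_nonneg/_le_hamiltonian` [folklore] -/
theorem leftEnergy_mem_Icc (P : OscillatorChain) (hU0 : ∀ q, 0 ≤ P.U q) (hV0 : ∀ r, 0 ≤ P.V r)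
    (N : ℕ) (i : Fin N) (x : PhaseSpace N) :
    0 ≤ leftEnergy P N i x ∧ leftEnergy P N i x ≤ P.hamiltonian N x := by
  have hw : ∀ k : Fin N, 0 ≤ blockWeight i k ∧ blockWeight i k ≤ 1 := fun k => by
    unfold blockWeight; split_ifs <;> norm_num
  have hb : ∀ k : Fin N, 0 ≤ bondWeight i k ∧ bondWeight i k ≤ 1 := fun k => by
    unfold bondWeight; split_ifs <;> norm_num
  unfold leftEnergy OscillatorChain.hamiltonian
  refine ⟨add_nonneg (Finset.sum_nonneg fun k _ => mul_nonneg (hw k).1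
      (add_nonneg (by positivity) (hU0 _))) (Finset.sum_nonneg fun k _ => Finset.sum_nonneg fun l _ => ?_),
    add_le_add (Finset.sum_le_sum fun k _ => ?_)
      (Finset.sum_le_sum fun k _ => Finset.sum_le_sum fun l _ => ?_)⟩
  · split_ifs
    · exact mul_nonneg (hb k).1 (hV0 _)
    · exact le_rfl
  · have h0 : 0 ≤ x.2 k ^ 2 / 2 + P.U (x.1 k) := add_nonneg (by positivity) (hU0 _)
    calc blockWeight i k * (x.2 k ^ 2 / 2 + P.U (x.1 k)) ≤ 1 * (x.2 k ^ 2 / 2 + P.U (x.1 k)) :=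
          mul_le_mul_of_nonneg_right (hw k).2 h0
      _ = _ := one_mul _
  · split_ifs
    · calc bondWeight i k * P.V (x.1 l - x.1 k) ≤ 1 * P.V (x.1 l - x.1 k) :=
            mul_le_mul_of_nonneg_right (hb k).2 (hV0 _)
        _ = _ := one_mul _
    · exact le_rfl

/-- `E_{≤i}` is invariant under each velocity flip (it depends on `p` through the `p_k²` only). [folklore] -/
theorem leftEnergy_momentumFlip (P : OscillatorChain) (i k : Fin N) (x : PhaseSpace N) :
    leftEnergy P N i (momentumFlip k x) = leftEnergy P N i x := by
  unfold leftEnergy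
  simp only [momentumFlip_fst]
  congr 1
  refine Finset.sum_congr rfl fun j _ => ?_
  by_cases h : j = k
  · subst h
    rw [momentumFlip_snd_self, neg_sq]
  · rw [momentumFlip_snd_of_ne h]

/-! ### The generator of the cut-off block energy -/

/-- **`L(E_{≤i} χ(H/R))` in closed form** (`N ≥ 1`, `γT_L, γT_R ≥ 0`, genuine bond `i + 1 < N`, `C²` data):
`χ(H/R)(γ(T_L − p_0²) − j_i) + E_{≤i}·L(χ(H/R)) + R⁻¹χ'(H/R)·Γ(H, E_{≤i})`, with the bath-only formula for
`L(χ(H/R))` and `Γ(H, E_{≤i}) = 2γT_L [0 ≤ i] p_0² + 2γT_R [N−1 ≤ i] p_{N-1}²`.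
[Bonetto–Lebowitz–Rey-Bellet 2000, §5.2 eqs. (25)–(26)] [folklore] -/
theorem generator_leftEnergy_cutoff (P : OscillatorChain) (hN : 0 < N) {T_L T_R : ℝ}
    (hγL : 0 ≤ P.γ * T_L) (hγR : 0 ≤ P.γ * T_R) (hU : ContDiff ℝ 2 P.U) (hV : ContDiff ℝ 2 P.V)
    {i : Fin N} (hi : i.val + 1 < N) (R : ℝ) (x : PhaseSpace N) :
    P.generator N T_L T_R (fun y => leftEnergy P N i y * smoothCutoff (P.hamiltonian N y / R)) x =
      smoothCutoff (P.hamiltonian N x / R) * (P.γ * (T_L - x.2 ⟨0, hN⟩ ^ 2) - P.bondCurrent N i x) +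
      leftEnergy P N i x * (P.γ *
        ((T_L * (deriv (deriv smoothCutoff) (P.hamiltonian N x / R) / R ^ 2 * x.2 ⟨0, hN⟩ ^ 2 +
            deriv smoothCutoff (P.hamiltonian N x / R) / R) -
          deriv smoothCutoff (P.hamiltonian N x / R) / R * x.2 ⟨0, hN⟩ ^ 2) +
        (T_R * (deriv (deriv smoothCutoff) (P.hamiltonian N x / R) / R ^ 2 *
              x.2 ⟨N - 1, Nat.sub_lt hN one_pos⟩ ^ 2 +
            deriv smoothCutoff (P.hamiltonian N x / R) / R) -
          deriv smoothCutoff (P.hamiltonian N x / R) / R * x.2 ⟨N - 1, Nat.sub_lt hN one_pos⟩ ^ 2))) +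
      deriv smoothCutoff (P.hamiltonian N x / R) / R *
        (Real.sqrt (2 * P.γ * T_L) ^ 2 * (x.2 ⟨0, hN⟩ * (blockWeight i ⟨0, hN⟩ * x.2 ⟨0, hN⟩)) +
          Real.sqrt (2 * P.γ * T_R) ^ 2 * (x.2 ⟨N - 1, Nat.sub_lt hN one_pos⟩ *
            (blockWeight i ⟨N - 1, Nat.sub_lt hN one_pos⟩ * x.2 ⟨N - 1, Nat.sub_lt hN one_pos⟩))) := by
  have hH2 : ContDiff ℝ 2 (P.hamiltonian N) := P.contDiff_hamiltonian hU hV N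
  have hHd : Differentiable ℝ (P.hamiltonian N) := hH2.differentiable (by norm_num)
  have hE2 : ContDiff ℝ 2 (leftEnergy P N i) := contDiff_leftEnergy' P hU hV N i
  have hEd : Differentiable ℝ (leftEnergy P N i) := hE2.differentiable (by norm_num)
  have hLE : P.generator N T_L T_R (leftEnergy P N i) x =
      P.γ * (T_L - x.2 ⟨0, hN⟩ ^ 2) - P.bondCurrent N i x := by
    have e := bondCurrent_add_generator_leftEnergy P (hU.differentiable (by norm_num))
      (hV.differentiable (by norm_num)) hi T_L T_R x
    rw [LinearResponseFTUR.sum_ite_val_eq hN (fun k => T_L - x.2 k ^ 2)] at e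
    linarith
  rw [generator_mul_cutoff P hN hγL hγR hH2 hE2 R x, hLE,
    generator_comp_hamiltonian_closed P hN hHd (hasDerivAt_scaled_smoothCutoff R)
      (hasDerivAt_deriv_scaled_smoothCutoff R) T_L T_R x,
    carreDuChamp_hamiltonian P hN hHd hEd T_L T_R x, partialP_leftEnergy P i ⟨0, hN⟩,
    partialP_leftEnergy P i ⟨N - 1, Nat.sub_lt hN one_pos⟩]

/-! ### Uniform bounds on the terms supported in the cut-off shell `{R ≤ H ≤ 2R}` -/

/-- `|E_{≤i} · R⁻²χ''(H/R) · p_k²| ≤ 8‖χ''‖_∞` (`U, V ≥ 0`, `R > 0`): on the support `E ≤ H ≤ 2R`, `p² ≤ 4R`.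
[folklore] -/
theorem abs_leftEnergy_mul_dd_mul_sq_le (P : OscillatorChain) (hU0 : ∀ q, 0 ≤ P.U q)
    (hV0 : ∀ r, 0 ≤ P.V r) {M₂ : ℝ} (hM₂0 : 0 ≤ M₂) (hM₂ : ∀ u, |deriv (deriv smoothCutoff) u| ≤ M₂)
    {R : ℝ} (hR : 0 < R) (i k : Fin N) (x : PhaseSpace N) :
    |leftEnergy P N i x * (deriv (deriv smoothCutoff) (P.hamiltonian N x / R) / R ^ 2 * x.2 k ^ 2)| ≤
      8 * M₂ := by
  obtain ⟨hE0, hEH⟩ := leftEnergy_mem_Icc P hU0 hV0 N i x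
  by_cases hx : P.hamiltonian N x ≤ 2 * R
  · have hp : x.2 k ^ 2 ≤ 4 * R := by
      have h1 := P.site_le_hamiltonian hU0 hV0 N x k
      have h2 := hU0 (x.1 k)
      linarith
    have hE : leftEnergy P N i x ≤ 2 * R := hEH.trans hx
    rw [abs_mul, abs_mul, abs_div, abs_of_nonneg hE0, abs_of_nonneg (sq_nonneg (x.2 k)),
      abs_of_pos (by positivity : (0 : ℝ) < R ^ 2)]
    calc leftEnergy P N i x * (|deriv (deriv smoothCutoff) (P.hamiltonian N x / R)| / R ^ 2 * x.2 k ^ 2)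
        ≤ (2 * R) * (M₂ / R ^ 2 * (4 * R)) := by
          refine mul_le_mul hE ?_ (by positivity) (by positivity)
          exact mul_le_mul (div_le_div_of_nonneg_right (hM₂ _) (by positivity)) hp (sq_nonneg _)
            (by positivity)
      _ = 8 * M₂ := by field_simp; ring
  · have h2 : deriv (deriv smoothCutoff) (P.hamiltonian N x / R) = 0 := by
      refine deriv_deriv_smoothCutoff_eq_zero_of_notMem fun h => ?_
      have := h.2
      rw [div_le_iff₀ hR] at this
      exact hx (by linarith)
    rw [h2, zero_div, zero_mul, mul_zero, abs_zero]
    positivity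

/-- `|E_{≤i} · R⁻¹χ'(H/R)| ≤ 2‖χ'‖_∞` (`U, V ≥ 0`, `R > 0`). [folklore] -/
theorem abs_leftEnergy_mul_d_le (P : OscillatorChain) (hU0 : ∀ q, 0 ≤ P.U q)
    (hV0 : ∀ r, 0 ≤ P.V r) {M₁ : ℝ} (hM₁0 : 0 ≤ M₁) (hM₁ : ∀ u, |deriv smoothCutoff u| ≤ M₁)
    {R : ℝ} (hR : 0 < R) (i : Fin N) (x : PhaseSpace N) :
    |leftEnergy P N i x * (deriv smoothCutoff (P.hamiltonian N x / R) / R)| ≤ 2 * M₁ := by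
  obtain ⟨hE0, hEH⟩ := leftEnergy_mem_Icc P hU0 hV0 N i x
  by_cases hx : P.hamiltonian N x ≤ 2 * R
  · have hE : leftEnergy P N i x ≤ 2 * R := hEH.trans hx
    rw [abs_mul, abs_div, abs_of_nonneg hE0, abs_of_pos hR]
    calc leftEnergy P N i x * (|deriv smoothCutoff (P.hamiltonian N x / R)| / R)
        ≤ (2 * R) * (M₁ / R) :=
          mul_le_mul hE (div_le_div_of_nonneg_right (hM₁ _) hR.le) (by positivity) (by positivity)
      _ = 2 * M₁ := by field_simp
  · have h2 : deriv smoothCutoff (P.hamiltonian N x / R) = 0 := by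
      refine deriv_smoothCutoff_eq_zero_of_notMem fun h => ?_
      have := h.2
      rw [div_le_iff₀ hR] at this
      exact hx (by linarith)
    rw [h2, zero_div, mul_zero, abs_zero]
    positivity

/-- Along `R = n + 1 → ∞` the second derivative of the cut-off factor at a fixed point is eventually `0`.
[folklore] -/
theorem eventually_deriv_deriv_smoothCutoff_hamiltonian_eq_zero (P : OscillatorChain) (x : PhaseSpace N) :
    ∀ᶠ n : ℕ in atTop, deriv (deriv smoothCutoff) (P.hamiltonian N x / ((n : ℝ) + 1)) = 0 := by
  refine eventually_atTop.2 ⟨⌈P.hamiltonian N x⌉₊, fun n hn => ?_⟩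
  refine (smoothCutoff_div_of_lt (by positivity) ?_).2.2
  have h1 := Nat.le_ceil (P.hamiltonian N x)
  have h2 : (⌈P.hamiltonian N x⌉₊ : ℝ) ≤ n := by exact_mod_cast hn
  linarith

/-! ### Registered sub-goal (brick 1/3 of stub S3) -/

/-- **Registered sub-goal `stubS3_flipWeakEquation`** (brick for stub S3 `stub_noisyPositiveConductance` of
crux stmt-AtomisticToContinuum-11976): a weak steady state of the flip-noisy chain `L + εS` (any chain `P`, any
rate `ε`) satisfies the deterministic weak Fokker–Planck equation `∫ L f dμ = 0` on every flip-invariant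
`f ∈ C_c^∞` — the form in which all energy bookkeeping (functions of `H`, cut-off block energies) is tested.
[Bernardin–Olla 2011, §2.1] [folklore] -/
theorem stubS3_flipWeakEquation :
    ∀ (N : ℕ) (P : OscillatorChain) (T_L T_R ε : ℝ) (μ : Measure (PhaseSpace N)),
      P.IsFlipSteadyState N T_L T_R ε μ → ∀ f : PhaseSpace N → ℝ,
        ContDiff ℝ ((⊤ : ℕ∞) : WithTop ℕ∞) f → HasCompactSupport f →
          (∀ (i : Fin N) (x : PhaseSpace N), f (momentumFlip i x) = f x) →
            ∫ x, P.generator N T_L T_R f x ∂μ = 0 :=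
  fun _ _ _ _ _ _ hμ _ hf hfc hinv => integral_generator_eq_zero_of_flipInvariant hμ hf hfc hinv

end Summit.AtomisticToContinuum.FouriersLaw.Theorems.VanishingNoiseBound

end
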